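import Literature.NumberTheory.EllipticCurves.CasselsTateParity
import HarnessLib

/-!
# Isogeny-pair parity for `p`-primary groups

Topic `Literature/NumberTheory/EllipticCurves`, family `bsd`. Pure group theory behind the `Ш`-part
of Cassels' formula for an isogeny `φ : E → E'` of prime degree `p` and its dual `φ̂`
(Cassels 1965, "Arithmetic on curves of genus 1, VIII"; Milne, *Arithmetic Duality Theorems*, I.§6,
around Thm 6.13 / Rem 6.10): with `A = Ш(E)[p^∞]`, `A' = Ш(E')[p^∞]` carrying their Cassels–Tate
pairings (alternating, left kernel = divisible elements) and `f = Ш(φ)`, `g = Ш(φ̂)` (`g ∘ f = p`,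
`f ∘ g = p`, adjoint for the pairings),

  `corank_{ℤ_p} A' + dim_{𝔽_p} ker f + dim_{𝔽_p} ker g ≡ 0 (mod 2)`.

* `exists_natCard_ker_even_zpCorank_of_adjoint` (**the statement**): for `p`-primary abelian groups
  `A`, `A'` with finite `p`-torsion, alternating pairings `B`, `B'` with values in `Q`, `Q[p] ↪ 𝔽_p`,
  whose left kernels are `p^∞`-divisible, and an adjoint pair `f : A → A'`, `g : A' → A` with
  `g f = p`, `f g = p`: `#ker f = p^m`, `#ker g = p^n` and `zpCorank A' p + m + n` is even.
  The two genuinely finite-dimensional inputs enter as explicit hypotheses, proved elsewhere in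
  the tree: `hfin`, the same parity statement for FINITE groups with NONDEGENERATE pairings
  (where the corank term is absent), and `hzp`, the computation `p ^ zpCorank A p = #(A[p] ∩ p^k A)`
  of the corank formula `Literature.NumberTheory.EllipticCurves.zpCorank` of a `p`-primary group
  whose chain `A[p] ∩ p^k A` is stable from `k` on.

## Proof

Choose `k` past the stability indices of both chains `A[p] ∩ p^k A`, `A'[p] ∩ p^k A'`
(`exists_torsionBy_inf_range_stable`), and put `C = p^k A`, `C' = p^k A'`. These are
`p^∞`-divisible (`exists_nsmul_eq_of_stable`), so `B`, `B'` vanish on them and descend to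
nondegenerate alternating pairings on the finite quotients `T = A/C`, `T' = A'/C'` (exactly as in
`exists_natCard_modN_eq_pow_two_mul_of_pairing`); `f`, `g` descend to an adjoint pair `f̄`, `ḡ`,
and `hfin` gives `#ker f̄ · #ker ḡ = p^{even}`. The bookkeeping between kernels upstairs and
downstairs happens inside the finite groups `A[p] ⊇ ker f`, `A'[p] ⊇ ker g`:
`#ker f = #ker f̄ · #(ker f ∩ C)` (the image of `ker f` in `T` is `ker f̄`, using the
`p`-divisibility of `C'` and `f g = p`), `ker f ∩ C = g(A'[p] ∩ C')`, and the kernel of `g` on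
`A'[p] ∩ C'` is `ker g ∩ C'`, whence `#(ker f ∩ C) · #(ker g ∩ C') = #(A'[p] ∩ C') = p^{corank A'}`
by `hzp`.

## References

* J. W. S. Cassels, *Arithmetic on curves of genus 1. VIII. On conjectures of Birch and
  Swinnerton-Dyer*, J. reine angew. Math. 217 (1965) 180–199 (motivation only).
* J. S. Milne, *Arithmetic Duality Theorems*, 2nd ed. (2006), I.§6 (motivation only).

The algebra proved here is folklore; no named facts are used.
-/

noncomputable section

open scoped Classical
open scoped AddSubgroup

namespace Literature.NumberTheory.EllipticCurves

universe u v

section Helpers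

variable {A : Type*} [AddCommGroup A] {A' : Type*} [AddCommGroup A'] {Q : Type*} [AddCommGroup Q]
  (p : ℕ)

/-- Counting along a homomorphism restricted to a subgroup: `#K = #f(K) · #(K ∩ ker f)`
(first isomorphism theorem for `f|_K`). [folklore] -/
theorem natCard_eq_natCard_map_mul_natCard_inf_ker (f : A →+ A') (K : AddSubgroup A) :
    Nat.card K = Nat.card (K.map f) * Nat.card ↥(K ⊓ f.ker) := by
  have h1 : Nat.card (f.ker.addSubgroupOf K) = Nat.card ↥(K ⊓ f.ker) := by
    rw [← AddSubgroup.inf_addSubgroupOf_left]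
    exact Nat.card_congr (AddSubgroup.addSubgroupOfEquivOfLe inf_le_left).toEquiv
  have h2 := (f.ker.addSubgroupOf K).card_mul_index
  have h3 : (f.ker.addSubgroupOf K).index = Nat.card (K.map f) := AddSubgroup.relIndex_ker K f
  rw [h1, h3] at h2
  rw [← h2, mul_comm]

/-- If `A` is `p`-primary and the chain `A[p] ∩ p^{k'} A` is stable from `k` on, then `C = p^k A`
is `p^j`-divisible inside itself for every `j` (iterate `exists_nsmul_eq_of_stable`). [folklore] -/
theorem exists_pow_nsmul_eq_of_stable (hA : ∀ a : A, ∃ n : ℕ, p ^ n • a = 0) {k : ℕ}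
    (hst : ∀ k', k ≤ k' → A[(p : ℤ)] ⊓ (nsmulAddMonoidHom (α := A) (p ^ k')).range =
      A[(p : ℤ)] ⊓ (nsmulAddMonoidHom (α := A) (p ^ k)).range) (j : ℕ) :
    ∀ c ∈ (nsmulAddMonoidHom (α := A) (p ^ k)).range,
      ∃ c' ∈ (nsmulAddMonoidHom (α := A) (p ^ k)).range, p ^ j • c' = c := by
  have hdiv : ∀ c ∈ (nsmulAddMonoidHom (α := A) (p ^ k)).range,
      ∃ c' ∈ (nsmulAddMonoidHom (α := A) (p ^ k)).range, p • c' = c := fun c hc ↦ by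
    obtain ⟨n, hn⟩ := hA c
    exact exists_nsmul_eq_of_stable p hst n c hc hn
  induction j with
  | zero => exact fun c hc ↦ ⟨c, hc, by rw [pow_zero, one_smul]⟩
  | succ j ih =>
    intro c hc
    obtain ⟨c₁, hc₁, rfl⟩ := ih c hc
    obtain ⟨c₂, hc₂, rfl⟩ := hdiv c₁ hc₁
    exact ⟨c₂, hc₂, by rw [pow_succ, ← smul_smul]⟩

/-- A bi-additive pairing on a `p`-primary group `A` vanishes on `C × A` as soon as `C` is
`p^j`-divisible for all `j`: `B(p^n c', b) = B(c', p^n b) = 0`. [folklore] -/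
theorem pairing_apply_eq_zero_of_divisible (hA : ∀ a : A, ∃ n : ℕ, p ^ n • a = 0)
    (B : A →+ A →+ Q) {C : AddSubgroup A}
    (hdiv : ∀ j : ℕ, ∀ c ∈ C, ∃ c' ∈ C, p ^ j • c' = c) : ∀ c ∈ C, ∀ b, B c b = 0 := by
  intro c hc b
  obtain ⟨n, hn⟩ := hA b
  obtain ⟨c', -, rfl⟩ := hdiv n c hc
  rw [map_nsmul, AddMonoidHom.nsmul_apply, ← map_nsmul, hn, map_zero]

/-- If `A[p]` is finite and `C = p^k A` is `p`-divisible inside itself, then `A / C` is finite: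
`(A/C)[p]` is the image of `A[p]`, so all `(A/C)[p^n]` are finite (`finite_torsionBy_pow`), and
`p^k (A/C) = 0`. [folklore] -/
theorem finite_quotient_range_of_divisible [Finite A[(p : ℤ)]] {k : ℕ}
    (hdiv : ∀ c ∈ (nsmulAddMonoidHom (α := A) (p ^ k)).range,
      ∃ c' ∈ (nsmulAddMonoidHom (α := A) (p ^ k)).range, p • c' = c) :
    Finite (A ⧸ (nsmulAddMonoidHom (α := A) (p ^ k)).range) := by
  set C : AddSubgroup A := (nsmulAddMonoidHom (α := A) (p ^ k)).range with hC
  haveI : Finite (A ⧸ C)[(p : ℤ)] := by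
    refine Finite.of_surjective (fun x : A[(p : ℤ)] ↦ (⟨QuotientAddGroup.mk (x : A), ?_⟩ :
      (A ⧸ C)[(p : ℤ)])) ?_
    · rw [AddSubgroup.torsionBy.nsmul_iff, ← QuotientAddGroup.mk_nsmul,
        AddSubgroup.torsionBy.nsmul_iff.mp x.2, QuotientAddGroup.mk_zero]
    · rintro ⟨z, hz⟩
      induction z using QuotientAddGroup.induction_on with
      | H a =>
        rw [AddSubgroup.torsionBy.nsmul_iff, ← QuotientAddGroup.mk_nsmul,
          QuotientAddGroup.eq_zero_iff] at hz
        obtain ⟨c, hc, hca⟩ := hdiv _ hz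
        refine ⟨⟨a - c, ?_⟩, Subtype.ext ?_⟩
        · rw [AddSubgroup.torsionBy.nsmul_iff, smul_sub, hca, sub_self]
        · change (QuotientAddGroup.mk (a - c) : A ⧸ C) = QuotientAddGroup.mk a
          rw [QuotientAddGroup.mk_sub, (QuotientAddGroup.eq_zero_iff c).mpr hc, sub_zero]
  haveI := finite_torsionBy_pow (A ⧸ C) p k
  refine Finite.of_injective (fun z : A ⧸ C ↦ (⟨z, ?_⟩ : (A ⧸ C)[((p ^ k : ℕ) : ℤ)]))
    (fun z w h ↦ congrArg Subtype.val h)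
  induction z using QuotientAddGroup.induction_on with
  | H a =>
    rw [AddSubgroup.torsionBy.nsmul_iff, ← QuotientAddGroup.mk_nsmul, QuotientAddGroup.eq_zero_iff]
    exact ⟨a, rfl⟩

/-- **Kernels downstairs.** For `f : A → A'`, `g : A' → A` with `f ∘ g = p`, subgroups `C ≤ A`,
`C' ≤ A'` with `f(C) ⊆ C'`, `g(C') ⊆ C` and `C'` `p`-divisible inside itself, the image of `ker f`
in `A / C` is exactly the kernel of the induced map `f̄ : A/C → A'/C'`: if `f a = p c'` with
`c' ∈ C'` then `a - g c' ∈ ker f` has the same class. [folklore] -/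
theorem map_mk'_ker_eq_ker_map {C : AddSubgroup A} {C' : AddSubgroup A'} (f : A →+ A')
    (g : A' →+ A) (hfg : ∀ y, f (g y) = p • y) (hC' : ∀ c ∈ C', ∃ c'' ∈ C', p • c'' = c)
    (hgC' : C' ≤ C.comap g) (hfC : C ≤ C'.comap f) :
    f.ker.map (QuotientAddGroup.mk' C) = (QuotientAddGroup.map C C' f hfC).ker := by
  ext z
  constructor
  · rintro ⟨x, hx, rfl⟩
    rw [AddMonoidHom.mem_ker, QuotientAddGroup.mk'_apply, QuotientAddGroup.map_mk,
      (AddMonoidHom.mem_ker).mp hx, QuotientAddGroup.mk_zero]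
  · intro hz
    induction z using QuotientAddGroup.induction_on with
    | H a =>
      rw [AddMonoidHom.mem_ker, QuotientAddGroup.map_mk, QuotientAddGroup.eq_zero_iff] at hz
      obtain ⟨c', hc', hc'eq⟩ := hC' _ hz
      have hgc' : g c' ∈ C := hgC' hc'
      refine ⟨a - g c', ?_, ?_⟩
      · rw [SetLike.mem_coe, AddMonoidHom.mem_ker, map_sub, hfg, hc'eq, sub_self]
      · rw [QuotientAddGroup.mk'_apply, QuotientAddGroup.mk_sub,
          (QuotientAddGroup.eq_zero_iff (g c')).mpr hgc', sub_zero]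

/-- **Kernels inside `C`.** With `g ∘ f = p`, `f ∘ g = p`, `f(C) ⊆ C'`, `g(C') ⊆ C` and `C`
`p`-divisible inside itself, `ker f ∩ C = g(A'[p] ∩ C')`: an element `x = p x₂` (`x₂ ∈ C`) of
`ker f ∩ C` is `g (f x₂)` with `f x₂ ∈ A'[p] ∩ C'`. [folklore] -/
theorem ker_inf_eq_map_torsionBy_inf {C : AddSubgroup A} {C' : AddSubgroup A'} (f : A →+ A')
    (g : A' →+ A) (hgf : ∀ x, g (f x) = p • x) (hfg : ∀ y, f (g y) = p • y)
    (hC : ∀ c ∈ C, ∃ c'' ∈ C, p • c'' = c) (hfC : C ≤ C'.comap f) (hgC' : C' ≤ C.comap g) :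
    f.ker ⊓ C = (A'[(p : ℤ)] ⊓ C').map g := by
  ext x
  simp only [AddSubgroup.mem_inf, AddSubgroup.mem_map, AddMonoidHom.mem_ker]
  constructor
  · rintro ⟨hfx, hxC⟩
    obtain ⟨x₂, hx₂, rfl⟩ := hC x hxC
    refine ⟨f x₂, ⟨?_, hfC hx₂⟩, hgf x₂⟩
    rw [AddSubgroup.torsionBy.nsmul_iff, ← map_nsmul, hfx]
  · rintro ⟨y, ⟨hy, hyC'⟩, rfl⟩
    exact ⟨by rw [hfg, AddSubgroup.torsionBy.nsmul_iff.mp hy], hgC' hyC'⟩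

variable [hp : Fact p.Prime]

/-- A finite abelian group killed by the prime `p` is an `𝔽_p`-vector space, so its order is a
power of `p` (private local copy of the tree's `exists_natCard_eq_pow_of_nsmul_eq_zero` of
`BSDRankZeroDensity`, not imported here). [folklore] -/
private theorem exists_natCard_eq_pow_of_prime_nsmul_eq_zero (H : Type*) [AddCommGroup H] [Finite H]
    (hH : ∀ x : H, p • x = 0) : ∃ m : ℕ, Nat.card H = p ^ m := by
  letI : Module (ZMod p) H := AddCommGroup.zmodModule hH
  exact ⟨Module.finrank (ZMod p) H,
    (Literature.NumberTheory.EllipticCurves.pow_finrank_eq_natCard (p := p) H).symm⟩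

end Helpers

/-- **Isogeny-pair parity for `p`-primary groups.** Let `A`, `A'` be `p`-primary abelian groups
with finite `p`-torsion, `B : A × A → Q`, `B' : A' × A' → Q` alternating bi-additive pairings with
`Q[p] ↪ 𝔽_p` whose left kernels consist of `p^∞`-divisible elements, and `f : A → A'`,
`g : A' → A` homomorphisms with `g ∘ f = p`, `f ∘ g = p`, adjoint: `B'(f x, y) = B(x, g y)`. Then
`#ker f = p^m`, `#ker g = p^n` with `zpCorank A' p + m + n` even. The hypotheses `hfin` (the finite,
nondegenerate case: `m + n` even) and `hzp` (`p ^ zpCorank A p = #(A[p] ∩ p^k A)` once the chain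
`A[p] ∩ p^k A` is stable from `k`) are the two finite-dimensional inputs, stated verbatim so that
this reduction is unconditional. For `A = Ш(E)[p^∞]`, `A' = Ш(E')[p^∞]`, `f = Ш(φ)`, `g = Ш(φ̂)`
this is the `Ш`-part of Cassels' formula (Cassels 1965; Milne, *ADT*, I.§6). [folklore] -/
theorem exists_natCard_ker_even_zpCorank_of_adjoint
    (hfin : ∀ {T T' : Type u} {Q : Type v} [AddCommGroup T] [AddCommGroup T'] [AddCommGroup Q]
      [Finite T] [Finite T'] (p : ℕ) [Fact p.Prime]
      (_hT : ∀ t : T, ∃ n : ℕ, p ^ n • t = 0) (_hT' : ∀ t : T', ∃ n : ℕ, p ^ n • t = 0)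
      (ι : Q[(p : ℤ)] →+ ZMod p) (_hι : Function.Injective ι)
      (b : T →+ T →+ Q) (b' : T' →+ T' →+ Q)
      (_hb : ∀ x, b x x = 0) (_hb' : ∀ y, b' y y = 0)
      (_hbnd : ∀ x, (∀ y, b x y = 0) → x = 0) (_hb'nd : ∀ x, (∀ y, b' x y = 0) → x = 0)
      (f : T →+ T') (g : T' →+ T)
      (_hgf : ∀ x, g (f x) = p • x) (_hfg : ∀ y, f (g y) = p • y)
      (_hadj : ∀ x y, b' (f x) y = b x (g y)),
      ∃ m n : ℕ, Nat.card f.ker = p ^ m ∧ Nat.card g.ker = p ^ n ∧ Even (m + n))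
    (hzp : ∀ {A : Type u} [AddCommGroup A] (p : ℕ) [Fact p.Prime]
      (_hA : ∀ a : A, ∃ n : ℕ, p ^ n • a = 0) [Finite A[(p : ℤ)]] {k : ℕ}
      (_hst : ∀ k', k ≤ k' → A[(p : ℤ)] ⊓ (nsmulAddMonoidHom (α := A) (p ^ k')).range =
        A[(p : ℤ)] ⊓ (nsmulAddMonoidHom (α := A) (p ^ k)).range),
      p ^ zpCorank A p = Nat.card ↥(A[(p : ℤ)] ⊓ (nsmulAddMonoidHom (α := A) (p ^ k)).range))
    {A A' : Type u} {Q : Type v} [AddCommGroup A] [AddCommGroup A'] [AddCommGroup Q]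
    (p : ℕ) [Fact p.Prime]
    (hA : ∀ a : A, ∃ n : ℕ, p ^ n • a = 0) (hA' : ∀ a : A', ∃ n : ℕ, p ^ n • a = 0)
    [Finite A[(p : ℤ)]] [Finite A'[(p : ℤ)]]
    (ι : Q[(p : ℤ)] →+ ZMod p) (hι : Function.Injective ι)
    (B : A →+ A →+ Q) (B' : A' →+ A' →+ Q) (hB : ∀ x, B x x = 0) (hB' : ∀ y, B' y y = 0)
    (hker : ∀ a, (∀ b, B a b = 0) → ∀ k : ℕ, a ∈ (nsmulAddMonoidHom (α := A) (p ^ k)).range)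
    (hker' : ∀ a, (∀ b, B' a b = 0) → ∀ k : ℕ, a ∈ (nsmulAddMonoidHom (α := A') (p ^ k)).range)
    (f : A →+ A') (g : A' →+ A) (hgf : ∀ x, g (f x) = p • x) (hfg : ∀ y, f (g y) = p • y)
    (hadj : ∀ x y, B' (f x) y = B x (g y)) :
    ∃ m n : ℕ, Nat.card f.ker = p ^ m ∧ Nat.card g.ker = p ^ n ∧
      Even (zpCorank A' p + m + n) := by
  have hp : Fact p.Prime := inferInstance
  -- (0) a common stability index `k` for the chains `A[p] ∩ p^k A`, `A'[p] ∩ p^k A'`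
  obtain ⟨k₁, h₁⟩ := exists_torsionBy_inf_range_stable (A := A) p
  obtain ⟨k₂, h₂⟩ := exists_torsionBy_inf_range_stable (A := A') p
  set k : ℕ := max k₁ k₂ with hk
  have hst : ∀ k', k ≤ k' →
      A[(p : ℤ)] ⊓ (nsmulAddMonoidHom (α := A) (p ^ k')).range =
        A[(p : ℤ)] ⊓ (nsmulAddMonoidHom (α := A) (p ^ k)).range := fun k' hk' ↦ by
    rw [h₁ k' ((le_max_left _ _).trans hk'), h₁ k (le_max_left _ _)]
  have hst' : ∀ k', k ≤ k' →
      A'[(p : ℤ)] ⊓ (nsmulAddMonoidHom (α := A') (p ^ k')).range =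
        A'[(p : ℤ)] ⊓ (nsmulAddMonoidHom (α := A') (p ^ k)).range := fun k' hk' ↦ by
    rw [h₂ k' ((le_max_right _ _).trans hk'), h₂ k (le_max_right _ _)]
  -- (6) the corank of `A'` is `#(A'[p] ∩ p^k A')`
  have hz := hzp p hA' hst'
  set C : AddSubgroup A := (nsmulAddMonoidHom (α := A) (p ^ k)).range with hC
  set C' : AddSubgroup A' := (nsmulAddMonoidHom (α := A') (p ^ k)).range with hC'
  -- (1) `C`, `C'` are `p^∞`-divisible
  have hdivj : ∀ j, ∀ c ∈ C, ∃ c' ∈ C, p ^ j • c' = c := exists_pow_nsmul_eq_of_stable p hA hst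
  have hdivj' : ∀ j, ∀ c ∈ C', ∃ c' ∈ C', p ^ j • c' = c :=
    exists_pow_nsmul_eq_of_stable p hA' hst'
  have hdiv : ∀ c ∈ C, ∃ c' ∈ C, p • c' = c := fun c hc ↦ by
    simpa only [pow_one] using hdivj 1 c hc
  have hdiv' : ∀ c ∈ C', ∃ c' ∈ C', p • c' = c := fun c hc ↦ by
    simpa only [pow_one] using hdivj' 1 c hc
  -- (2) `B`, `B'` vanish on `C`, `C'`; `f(C) ⊆ C'`, `g(C') ⊆ C`
  have hC₁ : ∀ c ∈ C, ∀ b, B c b = 0 := pairing_apply_eq_zero_of_divisible p hA B hdivj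
  have hC₂ : ∀ a, ∀ c ∈ C, B a c = 0 := fun a c hc ↦ by
    rw [Literature.GroupTheory.FiniteAbelian.eq_neg_of_alternating B hB, hC₁ c hc a, neg_zero]
  have hC'₁ : ∀ c ∈ C', ∀ b, B' c b = 0 := pairing_apply_eq_zero_of_divisible p hA' B' hdivj'
  have hC'₂ : ∀ a, ∀ c ∈ C', B' a c = 0 := fun a c hc ↦ by
    rw [Literature.GroupTheory.FiniteAbelian.eq_neg_of_alternating B' hB', hC'₁ c hc a, neg_zero]
  have hfC : C ≤ C'.comap f := by
    rintro _ ⟨a, rfl⟩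
    rw [AddSubgroup.mem_comap]
    exact ⟨f a, by rw [nsmulAddMonoidHom_apply, nsmulAddMonoidHom_apply, map_nsmul]⟩
  have hgC' : C' ≤ C.comap g := by
    rintro _ ⟨a, rfl⟩
    rw [AddSubgroup.mem_comap]
    exact ⟨g a, by rw [nsmulAddMonoidHom_apply, nsmulAddMonoidHom_apply, map_nsmul]⟩
  -- (3) the finite quotients `T = A/C`, `T' = A'/C'`, their pairings and the induced maps
  haveI : Finite (A ⧸ C) := finite_quotient_range_of_divisible p hdiv
  haveI : Finite (A' ⧸ C') := finite_quotient_range_of_divisible p hdiv'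
  have hT : ∀ t : A ⧸ C, ∃ n : ℕ, p ^ n • t = 0 := fun t ↦ by
    induction t using QuotientAddGroup.induction_on with
    | H a =>
      obtain ⟨n, hn⟩ := hA a
      exact ⟨n, by rw [← QuotientAddGroup.mk_nsmul, hn, QuotientAddGroup.mk_zero]⟩
  have hT' : ∀ t : A' ⧸ C', ∃ n : ℕ, p ^ n • t = 0 := fun t ↦ by
    induction t using QuotientAddGroup.induction_on with
    | H a =>
      obtain ⟨n, hn⟩ := hA' a
      exact ⟨n, by rw [← QuotientAddGroup.mk_nsmul, hn, QuotientAddGroup.mk_zero]⟩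
  obtain ⟨b, hb⟩ := exists_quotient_pairing C B hC₁ hC₂
  obtain ⟨b', hb'⟩ := exists_quotient_pairing C' B' hC'₁ hC'₂
  have hbalt : ∀ z, b z z = 0 := fun z ↦ by
    induction z using QuotientAddGroup.induction_on with
    | H a => rw [hb, hB]
  have hb'alt : ∀ z, b' z z = 0 := fun z ↦ by
    induction z using QuotientAddGroup.induction_on with
    | H a => rw [hb', hB']
  have hbnd : ∀ z, (∀ w, b z w = 0) → z = 0 := fun z hz' ↦ by
    induction z using QuotientAddGroup.induction_on with
    | H a =>
      rw [QuotientAddGroup.eq_zero_iff, hC]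
      exact hker a (fun y ↦ by rw [← hb, hz']) k
  have hb'nd : ∀ z, (∀ w, b' z w = 0) → z = 0 := fun z hz' ↦ by
    induction z using QuotientAddGroup.induction_on with
    | H a =>
      rw [QuotientAddGroup.eq_zero_iff, hC']
      exact hker' a (fun y ↦ by rw [← hb', hz']) k
  set fbar : A ⧸ C →+ A' ⧸ C' := QuotientAddGroup.map C C' f hfC with hfbar
  set gbar : A' ⧸ C' →+ A ⧸ C := QuotientAddGroup.map C' C g hgC' with hgbar
  have hgf₀ : ∀ x, gbar (fbar x) = p • x := fun x ↦ by
    induction x using QuotientAddGroup.induction_on with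
    | H a => rw [QuotientAddGroup.map_mk, QuotientAddGroup.map_mk, hgf, QuotientAddGroup.mk_nsmul]
  have hfg₀ : ∀ y, fbar (gbar y) = p • y := fun y ↦ by
    induction y using QuotientAddGroup.induction_on with
    | H a => rw [QuotientAddGroup.map_mk, QuotientAddGroup.map_mk, hfg, QuotientAddGroup.mk_nsmul]
  have hadj₀ : ∀ x y, b' (fbar x) y = b x (gbar y) := fun x y ↦ by
    induction x using QuotientAddGroup.induction_on with
    | H a =>
      induction y using QuotientAddGroup.induction_on with
      | H a' => rw [QuotientAddGroup.map_mk, QuotientAddGroup.map_mk, hb', hb, hadj]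
  -- (4) the finite level
  obtain ⟨m₀, n₀, hm₀, hn₀, hev⟩ :=
    hfin p hT hT' ι hι b b' hbalt hb'alt hbnd hb'nd fbar gbar hgf₀ hfg₀ hadj₀
  -- (5) kernels upstairs vs downstairs
  have hkf : Nat.card f.ker = Nat.card fbar.ker * Nat.card ↥(f.ker ⊓ C) := by
    have := natCard_eq_natCard_map_mul_natCard_inf_ker (QuotientAddGroup.mk' C) f.ker
    rwa [map_mk'_ker_eq_ker_map p f g hfg hdiv' hgC' hfC, QuotientAddGroup.ker_mk'] at this
  have hkg : Nat.card g.ker = Nat.card gbar.ker * Nat.card ↥(g.ker ⊓ C') := by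
    have := natCard_eq_natCard_map_mul_natCard_inf_ker (QuotientAddGroup.mk' C') g.ker
    rwa [map_mk'_ker_eq_ker_map p g f hgf hdiv hfC hgC', QuotientAddGroup.ker_mk'] at this
  have hfker : f.ker ≤ A[(p : ℤ)] := fun x hx ↦ by
    rw [AddSubgroup.torsionBy.nsmul_iff, ← hgf, (AddMonoidHom.mem_ker).mp hx, map_zero]
  have hgker : g.ker ≤ A'[(p : ℤ)] := fun y hy ↦ by
    rw [AddSubgroup.torsionBy.nsmul_iff, ← hfg, (AddMonoidHom.mem_ker).mp hy, map_zero]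
  have hcount : Nat.card ↥(A'[(p : ℤ)] ⊓ C') =
      Nat.card ↥(f.ker ⊓ C) * Nat.card ↥(g.ker ⊓ C') := by
    have h := natCard_eq_natCard_map_mul_natCard_inf_ker g (A'[(p : ℤ)] ⊓ C')
    have hS : A'[(p : ℤ)] ⊓ C' ⊓ g.ker = g.ker ⊓ C' :=
      le_antisymm (fun y hy ↦ ⟨hy.2, hy.1.2⟩) (fun y hy ↦ ⟨⟨hgker hy.1, hy.2⟩, hy.1⟩)
    rw [← ker_inf_eq_map_torsionBy_inf p f g hgf hfg hdiv hfC hgC', hS] at h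
    exact h
  -- (7) orders of the kernels are powers of `p`, and the count
  haveI : Finite f.ker :=
    Finite.of_injective (AddSubgroup.inclusion hfker) (AddSubgroup.inclusion_injective hfker)
  haveI : Finite g.ker :=
    Finite.of_injective (AddSubgroup.inclusion hgker) (AddSubgroup.inclusion_injective hgker)
  obtain ⟨m, hm⟩ := exists_natCard_eq_pow_of_prime_nsmul_eq_zero p f.ker fun x ↦
    Subtype.ext (AddSubgroup.torsionBy.nsmul_iff.mp (hfker x.2))
  obtain ⟨n, hn⟩ := exists_natCard_eq_pow_of_prime_nsmul_eq_zero p g.ker fun y ↦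
    Subtype.ext (AddSubgroup.torsionBy.nsmul_iff.mp (hgker y.2))
  refine ⟨m, n, hm, hn, ?_⟩
  have key : p ^ (m + n) = p ^ (m₀ + n₀ + zpCorank A' p) := by
    rw [pow_add, pow_add, pow_add, ← hm, ← hn, ← hm₀, ← hn₀, hz, hkf, hkg, hcount]
    ring
  have hmn := Nat.pow_right_injective hp.out.two_le key
  obtain ⟨r, hr⟩ := hev
  exact ⟨r + zpCorank A' p, by omega⟩

end Literature.NumberTheory.EllipticCurves

end
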